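import Summits.AtomisticToContinuum.Crystallization.Theorems.FrustratedLawDichotomyStrainedPatchHomEntryLeafHTA2QCellG75SV1

/-!
# v3 ANCHOR CELL (T0) `cG75S × wG75S` (0.75 t_b, SEVEN-coarse: 2⁻¹⁰ on (0,0),(1,1), 2⁻⁹ else (k₆ = 4)), part 2: the p-dependent kernel facts `restG75SV` (≈ 80 s) and `linG75SV` (sharp linear pieces)
# (27623 `(H) HomFloor (1/625)`, hcp half; pre-staged by hand-1 g37, LANDED by hand-1 g38 on critic GO row 1436 (E) / 1437 (E) «T0 anchors»)

Kernel facts; 0 sorry; standard axioms.  `--supports stmt-AtomisticToContinuum-27623`.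
-/

namespace Summit.AtomisticToContinuum.Crystallization.Theorems.FrustratedLawDichotomyStrainedPatchHomEntryLeafHT

open Literature.Analysis.ValidatedNumerics.Numerics
open Summit.AtomisticToContinuum.Crystallization.Theorems.FrustratedLawDichotomyStrainedPatchHomCertTree (CertTree treeOK)
open Summit.AtomisticToContinuum.Crystallization.Theorems.FrustratedLawDichotomyStrainedPatchHomEntryTable (muRec)
open Summit.AtomisticToContinuum.Crystallization.Theorems.FrustratedLawDichotomyStrainedPatchHomEntryFitHcpCentred (entryLeafOKHQDCRS)
open Summit.AtomisticToContinuum.Crystallization.Theorems.FrustratedLawDichotomyStrainedPatchHomSlopeLJ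
open Summit.AtomisticToContinuum.Crystallization.Theorems.FrustratedLawDichotomyStrainedPatchHomSlopeLJAffine
open Summit.AtomisticToContinuum.Crystallization.Theorems.FrustratedLawDichotomyStrainedPatchHomSlopeLJAffine2Kit
open Summit.AtomisticToContinuum.Crystallization.Theorems.FrustratedLawDichotomyStrainedPatchHomSlopeLJAffine2KitS (rem3LJS)

set_option maxRecDepth 100000 in
set_option maxHeartbeats 4000000 in
/-- ★ KERNEL: the non-slope conjuncts of the certificate side for `pG75SV`. -/
theorem restG75SV : htCertRestA2 pG75SV JG75S cG75S wG75S = true := by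
  decide +kernel

set_option maxRecDepth 100000 in
set_option maxHeartbeats 4000000 in
/-- ★ KERNEL: `g₀ + lin + ⌈√ΣQ²⌉ + rem3♯ + nai = 738528909678 ≤ GnG75SV` (sharp third-order remainder `rem3LJS`). -/
theorem linG75SV : g0LJ cG75S (htScA2F cG75S wG75S JG75S (htNearU cG75S wG75S)) + linLJA cG75S wG75S JG75S (htScA2F cG75S wG75S JG75S (htNearU cG75S wG75S)) + sqrtQ QG75S +
    rem3LJS cG75S wG75S JG75S (htScA2F cG75S wG75S JG75S (htNearU cG75S wG75S)) + naiSLJ cG75S (hullW JG75S wG75S) (htSnA2F cG75S wG75S JG75S (htNearU cG75S wG75S)) ≤ GnG75SV := by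
  decide +kernel

end Summit.AtomisticToContinuum.Crystallization.Theorems.FrustratedLawDichotomyStrainedPatchHomEntryLeafHT
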